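import Summits.CriticalPhenomena.CardyFormulaZ2.Theorems.CardyBoundaryCoulombGasBoundaryDefectGaussianRStubRealisabilityPart38
import Summits.CriticalPhenomena.CardyFormulaZ2.Theorems.CardyBoundaryCoulombGasBoundaryDefectGaussianRStubRealisabilityPart14

/-!
# Stub `stub_dictionaryPositivity` of line `rainbow-monomials-in-excursion-kernels` — D2 completion,
# sub-goal `s17_forcedBits`: the arrow bits at CUT corners are forced
# (crux `BoundaryDefectGaussianR`, stmt-CriticalPhenomena-14132; insertion dictionary D2, layer 4)

In the assembly of the insertion dictionary `‖Zins V ι‖ = #{ω ⊆ E : Rainbow ι V ω}` the sum over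
valid height configurations `h` becomes a sum over ARROW ASSIGNMENTS `c ↦ bit h c`
(`bit M h c = [hv h x - hf h f = 1]` for the corner `c = (x, f)`, file
`CollarLegModelStrandsConsistency`). At a CUT corner (`CollarLegModel.IsCut`: frozen target and
inconsistent turn of the prescribed data, file `CollarLegModelRainbow`) the bit must not be a free
variable of that sum. THEOREM (`forcedBits`, registered one-line form `s17_forcedBits`): for an
ADMISSIBLE leg insertion `ι` on `V` whose insertion points are FLAT at radius `sinkLegs + 4` and
whose boundary vertices carry radius-`3` CHARTS, for all valid `h, h' ∈ (ι.model V).configs` and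
every cut corner `c` over the piece, `bit h c = bit h' c`.

Proof. Both cells of a cut corner carry `h`-INDEPENDENT heights (`heights_eq_of_isCut`):
* `c` UNTRACKED (`heights_indep_of_not_isTracked`): the vertex `x = ofSite c.1` is a vertex-cell
  (`c` lies over the piece) whose face `f = ofSite (cFace c)` is not a face-cell; every face at a
  vertex of `V` is a face-cell, so `x ∉ V` is a ghost, not a free vertex, and `f` is not a free
  face (free faces are face-cells): `hv h x = vertH x`, `hf h f = faceH f`.
* `c` TRACKED: by `tc_trackedCuts_are_ends` (Part 38; flatness at radius `sinkLegs + 3` follows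
  from radius `sinkLegs + 4`) `c` is a registered strand end, and at every strand end both cells
  carry `h`-independent heights (`fb_end_heights`, the positional analysis of `se_pairs_main`,
  Part 23): at a JUMP end the face is the collar face before/after the dart (prescribed) and the
  vertex is the free vertex of the jump edge, squeezed by validity to the middle of the two collar
  levels `ℓ, ℓ ± 2`; at a JUNCTION end the vertex is the ghost (prescribed) and the face the
  adjacent collar face (prescribed).
Hence `bit h c = bit h' c`.
-/

namespace Summit.CriticalPhenomena.CardyFormulaZ2.Cruxes.BoundaryDefectGaussianR.RainbowMonomialsInExcursionKernels

open Finset Literature.Probability.LatticeModels Literature.Probability.LatticeModels.CollarLegModel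

/-! ### Strand ends: both cells carry configuration-independent heights -/

section Ends

variable (ι : LegInsertionData) (V : Finset (ℤ × ℤ)) {d₀ : Dart} (hadm : ι.IsAdmissible V)
  (h : outDart V ι.sink = some d₀) {st : ℕ → WalkState}
  (hst : ∀ t, st t = List.foldl (fun s d => s.step (ι.startAt V d)) ι.init ((cycle V d₀).take t))

include hadm h hst in
/-- **The two cells at a strand end carry configuration-independent heights.** For an admissible
leg insertion with flat insertion points (radius `sinkLegs + 3`) and a strand end
`(c, m) ∈ ι.strandEnds V`, there are integers `a, b` with `hv hh x = a` and `hf hh f = b` for the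
vertex `x` and the face `f` of `c` in EVERY valid height configuration `hh`: at a jump end the
face is a prescribed collar face and the free vertex is pinned to the middle of the two collar
levels; at a junction end the ghost and the collar face are both prescribed (positional analysis
of `se_pairs_main`, Part 23). [folklore] -/
theorem fb_end_heights
    (hflat : ∀ x ∈ insert ι.sink ι.source, ∃ d : ℤ × ℤ, (d = (1, 0) ∨ d = (-1, 0) ∨ d = (0, 1) ∨ d = (0, -1)) ∧
      ∀ v : ℤ × ℤ, (v.1 - x.1) ^ 2 + (v.2 - x.2) ^ 2 ≤ ((ι.sinkLegs : ℤ) + 3) ^ 2 →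
        (v ∈ V ↔ 0 ≤ (v.1 - x.1) * d.1 + (v.2 - x.2) * d.2))
    {e : (Site 2 × Fin 4) × ℤ} (he : e ∈ ι.strandEnds V) :
    ∃ a b : ℤ, ∀ hh : ↥(ι.model V).freeCells → ℤ, (ι.model V).IsValid hh →
      (ι.model V).hv hh (ofSite e.1.1) = a ∧ (ι.model V).hf hh (ofSite (cFace e.1)) = b := by
  obtain ⟨t, ht, hte⟩ := (se_mem_strandEnds_iff ι V h hst).1 he
  have hact : (st (t + 1)).level ≠ (st t).level := fun h0 => by
    rw [se_endsAt_nil _ _ _ h0] at hte; simp at hte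
  obtain ⟨c, K, hch, hchp, hds, hpred1, hpred0⟩ := se_active_rail ι V hadm h hst hflat ht hact
  obtain ⟨-, hjw, hnjw⟩ := se_active_delta ι V hst ht hact
  obtain ⟨hcV, -, -⟩ := se_rail_local hch
  have hcVC : c ∈ (ι.model V).vertexCells := Finset.mem_union_left _ hcV
  obtain ⟨gf1, gf2, gf3, gf4⟩ := se_gapFace_eq_cFace c K
  rw [hds] at hte
  rcases se_endsAt_site _ _ _ hte with ⟨hj, hE⟩ | ⟨hnj, -, hE⟩
  · -- jump edge: free vertex `c` between the collar faces before and after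
    obtain ⟨hw0, hw1⟩ := hjw hj
    obtain ⟨hfa1, hfa2, hfa3⟩ := se_collar_face_after ι V hadm h hst ht hch hds hw1
    obtain ⟨hfb1, hfb2, hfb3⟩ := se_collar_face_before ι V hadm h hst ht hch hchp hpred1 hpred0 hw0
    have hcf := se_jump_vertex_free ι V hadm h hst ht hch hds hw0 hw1
    have key : ∀ hh : ↥(ι.model V).freeCells → ℤ, (ι.model V).IsValid hh →
        (ι.model V).hv hh c = ((st t).level + (st (t + 1)).level) / 2 ∧
        (ι.model V).hf hh (gapFace (c, K)) = (st (t + 1)).level ∧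
        (ι.model V).hf hh (gapFace (c - dir (K + 1), K)) = (st t).level := by
      intro hh hval
      have ha : (ι.model V).hf hh (gapFace (c, K)) = (st (t + 1)).level := by
        rw [hf_of_not_mem _ _ hfa2]; exact hfa3
      have hb : (ι.model V).hf hh (gapFace (c - dir (K + 1), K)) = (st t).level := by
        rw [hf_of_not_mem _ _ hfb2]; exact hfb3
      have v1 := hval c hcVC _ (se_gapFace_mem_vertexFaces c K).1 hfa1 (Or.inl hcf)
      have v2 := hval c hcVC _ (se_gapFace_mem_vertexFaces c K).2.1 hfb1 (Or.inl hcf)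
      rw [ha] at v1
      rw [hb] at v2
      exact ⟨se_middle_of_abs v2 v1 hj, ha, hb⟩
    rcases hE with rfl | rfl
    · refine ⟨((st t).level + (st (t + 1)).level) / 2, (st t).level, fun hh hval => ?_⟩
      obtain ⟨k1, -, k3⟩ := key hh hval
      simp only [ofSite_toSite]
      rw [← gf3, k1, k3]
      exact ⟨rfl, rfl⟩
    · refine ⟨((st t).level + (st (t + 1)).level) / 2, (st (t + 1)).level, fun hh hval => ?_⟩
      obtain ⟨k1, k2, -⟩ := key hh hval
      simp only [ofSite_toSite]
      rw [← gf1, k1, k2]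
      exact ⟨rfl, rfl⟩
  · -- junction: the ghost `c + dir K` against the collar face after (closing) / before (opening)
    have hw' := hnjw hnj
    rcases hE with ⟨hw, rfl⟩ | ⟨hw, rfl⟩
    · -- the arc closes: ghost prescribed, face after prescribed
      rw [hw] at hw'
      obtain ⟨-, hg2⟩ := se_ghost_cell ι V h hst ht hch hds (Or.inl hw)
      obtain ⟨-, hfa2, -⟩ := se_collar_face_after ι V hadm h hst ht hch hds (by simpa using hw')
      refine ⟨(ι.model V).C.vertH (c + dir K), (ι.model V).C.faceH (gapFace (c, K)), fun hh _ => ?_⟩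
      show (ι.model V).hv hh (ofSite (toSite (c + dir K))) = _ ∧
        (ι.model V).hf hh (ofSite (cFace (toSite (c + dir K), K + 1))) = _
      rw [ofSite_toSite, ← gf2, hv_of_not_mem _ _ hg2, hf_of_not_mem _ _ hfa2]
      exact ⟨rfl, rfl⟩
    · -- the arc opens: ghost prescribed, face before prescribed
      rw [hw] at hw'
      obtain ⟨-, hg2⟩ := se_ghost_cell ι V h hst ht hch hds (Or.inr (by simpa using hw'))
      obtain ⟨-, hfb2, -⟩ := se_collar_face_before ι V hadm h hst ht hch hchp hpred1 hpred0 hw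
      refine ⟨(ι.model V).C.vertH (c + dir K), (ι.model V).C.faceH (gapFace (c - dir (K + 1), K)),
        fun hh _ => ?_⟩
      show (ι.model V).hv hh (ofSite (toSite (c + dir K))) = _ ∧
        (ι.model V).hf hh (ofSite (cFace (toSite (c + dir K), K + 2))) = _
      rw [ofSite_toSite, ← gf4, hv_of_not_mem _ _ hg2, hf_of_not_mem _ _ hfb2]
      exact ⟨rfl, rfl⟩

end Ends

/-! ### Untracked corners over the piece: both cells are prescribed -/

/-- **An untracked corner over the piece has two prescribed cells.** If `c` lies over the piece of
a collar leg model `M` (its vertex `x` is a vertex-cell) but is not tracked (its face `f` is not a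
face-cell), then `x ∉ V` (every face at a vertex of `V` is a face-cell), so `x` is not a free
vertex, and `f` is not a free face (free faces are face-cells): both heights are the prescribed
ones in every configuration. [folklore] -/
theorem heights_indep_of_not_isTracked (M : CollarLegModel) {c : Site 2 × Fin 4}
    (hc : c ∈ Literature.Probability.Percolation.cornerSet M.piece) (htr : ¬M.IsTracked c)
    (hh : ↥M.freeCells → ℤ) :
    M.hv hh (ofSite c.1) = M.C.vertH (ofSite c.1) ∧ M.hf hh (ofSite (cFace c)) = M.C.faceH (ofSite (cFace c)) := by
  have hx : ofSite c.1 ∈ M.vertexCells := by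
    rw [Literature.Probability.Percolation.mem_cornerSet, piece, mem_image] at hc
    obtain ⟨v, hv, hvc⟩ := hc
    rw [← hvc, ofSite_toSite]; exact hv
  have hf : ofSite (cFace c) ∉ M.faceCells := fun hf => htr ⟨hx, hf⟩
  have hxV : ofSite c.1 ∉ M.V := fun hxV => hf (perCfg_isTracked_of_mem_V M hxV).2
  constructor
  · refine hv_of_not_mem _ _ fun hfree => hxV ?_
    rw [mem_freeCells_false, freeVerts, mem_sdiff] at hfree
    exact hfree.1
  · refine hf_of_not_mem _ _ fun hfree => hf ?_
    rw [mem_freeCells_true, freeFaces, mem_union] at hfree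
    rcases hfree with hint | hpk
    · exact (mem_filter.1 hint).1
    · exact (mem_filter.1 (mem_inter.1 hpk).2).1

/-! ### The theorem -/

/-- **The two cells of a cut corner carry configuration-independent heights.** For an ADMISSIBLE
leg insertion `ι` on `V` with insertion points FLAT at radius `sinkLegs + 3` and radius-`3` CHARTS
at the boundary vertices, a corner `c` over the piece of `ι.model V` that is a CUT, and two valid
height configurations `h, h'`: `hv h x = hv h' x` and `hf h f = hf h' f` for the vertex `x` and the
face `f` of `c` (untracked: `heights_indep_of_not_isTracked`; tracked: `c` is a strand end by
`tc_trackedCuts_are_ends`, Part 38, and `fb_end_heights`). [folklore] -/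
theorem heights_eq_of_isCut (ι : LegInsertionData) (V : Finset (ℤ × ℤ)) (hadm : ι.IsAdmissible V)
    (hflat : ∀ x ∈ insert ι.sink ι.source, ∃ dvec : ℤ × ℤ,
      (dvec = (1, 0) ∨ dvec = (-1, 0) ∨ dvec = (0, 1) ∨ dvec = (0, -1)) ∧
      ∀ v : ℤ × ℤ, (v.1 - x.1) ^ 2 + (v.2 - x.2) ^ 2 ≤ ((ι.sinkLegs : ℤ) + 3) ^ 2 →
        (v ∈ V ↔ 0 ≤ (v.1 - x.1) * dvec.1 + (v.2 - x.2) * dvec.2))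
    (hchart : ∀ u ∈ V, ∀ k : Fin 4, u + dir k ∉ V → ∃ (K : Fin 4) (c₁ c₂ : ℤ),
      (∀ v : ℤ × ℤ, |v.1 - u.1| ≤ 3 → |v.2 - u.2| ≤ 3 →
        (v ∈ V ↔ c₂ ≤ v.1 * (dir (K + 1)).1 + v.2 * (dir (K + 1)).2)) ∨
      (∀ v : ℤ × ℤ, |v.1 - u.1| ≤ 3 → |v.2 - u.2| ≤ 3 →
        (v ∈ V ↔ c₁ ≤ v.1 * (dir K).1 + v.2 * (dir K).2 ∧
          c₂ ≤ v.1 * (dir (K + 1)).1 + v.2 * (dir (K + 1)).2)) ∨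
      (∀ v : ℤ × ℤ, |v.1 - u.1| ≤ 3 → |v.2 - u.2| ≤ 3 →
        (v ∈ V ↔ c₂ ≤ v.1 * (dir (K + 1)).1 + v.2 * (dir (K + 1)).2 ∨
          v.1 * (dir K).1 + v.2 * (dir K).2 ≤ c₁)))
    {h h' : ↥(ι.model V).freeCells → ℤ} (hh : (ι.model V).IsValid h) (hh' : (ι.model V).IsValid h')
    {c : Site 2 × Fin 4} (hc : c ∈ Literature.Probability.Percolation.cornerSet (ι.model V).piece)
    (hcut : (ι.model V).IsCut c) :
    (ι.model V).hv h (ofSite c.1) = (ι.model V).hv h' (ofSite c.1) ∧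
      (ι.model V).hf h (ofSite (cFace c)) = (ι.model V).hf h' (ofSite (cFace c)) := by
  by_cases htr : (ι.model V).IsTracked c
  · obtain ⟨m, hm⟩ := tc_trackedCuts_are_ends ι V hadm hflat hchart c htr hcut
    obtain ⟨d₀, h₀, -⟩ := s3_of_admissible ι V hadm
    obtain ⟨a, b, hab⟩ := fb_end_heights ι V hadm h₀
      (st := fun t => List.foldl (fun s d => s.step (ι.startAt V d)) ι.init ((cycle V d₀).take t))
      (fun _ => rfl) hflat hm
    obtain ⟨h1, h2⟩ := hab h hh
    obtain ⟨h1', h2'⟩ := hab h' hh'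
    exact ⟨h1.trans h1'.symm, h2.trans h2'.symm⟩
  · obtain ⟨h1, h2⟩ := heights_indep_of_not_isTracked (ι.model V) hc htr h
    obtain ⟨h1', h2'⟩ := heights_indep_of_not_isTracked (ι.model V) hc htr h'
    exact ⟨h1.trans h1'.symm, h2.trans h2'.symm⟩

/-- **The arrow bits at cut corners are forced.** For an ADMISSIBLE leg insertion `ι` on `V` with
insertion points FLAT at radius `sinkLegs + 4` and radius-`3` CHARTS at the boundary vertices of
`V`, all valid configurations `h, h' ∈ (ι.model V).configs` and every CUT corner `c` over the piece:
`bit h c = bit h' c` — both cells of `c` carry configuration-independent heights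
(`heights_eq_of_isCut`; flatness at radius `sinkLegs + 3` follows from radius `sinkLegs + 4`).
[cite: BaxterKellandWu1976, §3–§4] -/
theorem forcedBits (ι : LegInsertionData) (V : Finset (ℤ × ℤ)) (hadm : ι.IsAdmissible V)
    (hflat : ∀ x ∈ insert ι.sink ι.source, ∃ dvec : ℤ × ℤ,
      (dvec = (1, 0) ∨ dvec = (-1, 0) ∨ dvec = (0, 1) ∨ dvec = (0, -1)) ∧
      ∀ v : ℤ × ℤ, (v.1 - x.1) ^ 2 + (v.2 - x.2) ^ 2 ≤ ((ι.sinkLegs : ℤ) + 4) ^ 2 →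
        (v ∈ V ↔ 0 ≤ (v.1 - x.1) * dvec.1 + (v.2 - x.2) * dvec.2))
    (hchart : ∀ u ∈ V, ∀ k : Fin 4, u + dir k ∉ V → ∃ (K : Fin 4) (c₁ c₂ : ℤ),
      (∀ v : ℤ × ℤ, |v.1 - u.1| ≤ 3 → |v.2 - u.2| ≤ 3 →
        (v ∈ V ↔ c₂ ≤ v.1 * (dir (K + 1)).1 + v.2 * (dir (K + 1)).2)) ∨
      (∀ v : ℤ × ℤ, |v.1 - u.1| ≤ 3 → |v.2 - u.2| ≤ 3 →
        (v ∈ V ↔ c₁ ≤ v.1 * (dir K).1 + v.2 * (dir K).2 ∧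
          c₂ ≤ v.1 * (dir (K + 1)).1 + v.2 * (dir (K + 1)).2)) ∨
      (∀ v : ℤ × ℤ, |v.1 - u.1| ≤ 3 → |v.2 - u.2| ≤ 3 →
        (v ∈ V ↔ c₂ ≤ v.1 * (dir (K + 1)).1 + v.2 * (dir (K + 1)).2 ∨
          v.1 * (dir K).1 + v.2 * (dir K).2 ≤ c₁)))
    (h : ↥(ι.model V).freeCells → ℤ) (hh : h ∈ (ι.model V).configs)
    (h' : ↥(ι.model V).freeCells → ℤ) (hh' : h' ∈ (ι.model V).configs)
    (c : Site 2 × Fin 4) (hc : c ∈ Literature.Probability.Percolation.cornerSet (ι.model V).piece)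
    (hcut : (ι.model V).IsCut c) : (ι.model V).bit h c = (ι.model V).bit h' c := by
  have hflat3 : ∀ x ∈ insert ι.sink ι.source, ∃ dvec : ℤ × ℤ,
      (dvec = (1, 0) ∨ dvec = (-1, 0) ∨ dvec = (0, 1) ∨ dvec = (0, -1)) ∧
      ∀ v : ℤ × ℤ, (v.1 - x.1) ^ 2 + (v.2 - x.2) ^ 2 ≤ ((ι.sinkLegs : ℤ) + 3) ^ 2 →
        (v ∈ V ↔ 0 ≤ (v.1 - x.1) * dvec.1 + (v.2 - x.2) * dvec.2) := by
    intro x hx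
    obtain ⟨dvec, hd, hV⟩ := hflat x hx
    refine ⟨dvec, hd, fun v hv => hV v (le_trans hv ?_)⟩
    have hL : (0 : ℤ) ≤ (ι.sinkLegs : ℤ) := Int.natCast_nonneg _
    nlinarith
  obtain ⟨h1, h2⟩ := heights_eq_of_isCut ι V hadm hflat3 hchart
    ((mem_configs_iff_isValid _ h).1 hh) ((mem_configs_iff_isValid _ h').1 hh') hc hcut
  unfold bit
  rw [h1, h2]

/-! ### Registered one-line form -/

/-- **Sub-goal `s17_forcedBits`** of the D2 completion (registered on stmt-CriticalPhenomena-14132,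
W5 anchor of the insertion dictionary): for an ADMISSIBLE leg insertion `ι` on `V` whose insertion
points are FLAT at radius `sinkLegs + 4` and whose boundary vertices carry radius-`3` CHARTS, the
ARROW BIT at every CUT corner over the piece of the jump collar `ι.model V` is the same in all
valid height configurations: `∀ h h' ∈ configs, ∀ c ∈ cornerSet piece, IsCut c → bit h c = bit h' c`.
[cite: BaxterKellandWu1976, §3–§4] -/
theorem s17_forcedBits : ∀ (ι : Literature.Probability.LatticeModels.CollarLegModel.LegInsertionData) (V : Finset (ℤ × ℤ)), ι.IsAdmissible V → (∀ x ∈ insert ι.sink ι.source, ∃ dvec : ℤ × ℤ, (dvec = (1, 0) ∨ dvec = (-1, 0) ∨ dvec = (0, 1) ∨ dvec = (0, -1)) ∧ ∀ v : ℤ × ℤ, (v.1 - x.1) ^ 2 + (v.2 - x.2) ^ 2 ≤ ((ι.sinkLegs : ℤ) + 4) ^ 2 → (v ∈ V ↔ 0 ≤ (v.1 - x.1) * dvec.1 + (v.2 - x.2) * dvec.2)) → (∀ u ∈ V, ∀ k : Fin 4, u + Literature.Probability.LatticeModels.CollarLegModel.dir k ∉ V → ∃ (K : Fin 4) (c₁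 c₂ : ℤ), (∀ v : ℤ × ℤ, |v.1 - u.1| ≤ 3 → |v.2 - u.2| ≤ 3 → (v ∈ V ↔ c₂ ≤ v.1 * (Literature.Probability.LatticeModels.CollarLegModel.dir (K + 1)).1 + v.2 * (Literature.Probability.LatticeModels.CollarLegModel.dir (K + 1)).2)) ∨ (∀ v : ℤ × ℤ, |v.1 - u.1| ≤ 3 → |v.2 - u.2| ≤ 3 → (v ∈ V ↔ c₁ ≤ v.1 * (Literature.Probability.LatticeModels.CollarLegModel.dir K).1 + v.2 * (Literature.Probability.LatticeModels.CollarLegModel.dir K).2 ∧ c₂ ≤ v.1 * (Literature.Probability.LatticeModels.CollarLegModel.dir (K + 1)).1 + v.2 * (Literature.Probability.LatticeModels.CollarLegModel.dir (K + 1)).2)) ∨ (∀ v : ℤ × ℤ, |v.1 - u.1| ≤ 3 → |v.2 - u.2| ≤ 3 → (v ∈ V ↔ c₂ ≤ v.1 * (Literature.Probability.LatticeModels.CollarLegModel.dir (K + 1)).1 + v.2 * (Literature.Probability.LatticeModels.CollarLegModel.dir (K + 1)).2 ∨ v.1 * (Literature.Probability.LatticeModels.CollarLegModel.dir K).1 +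 v.2 * (Literature.Probability.LatticeModels.CollarLegModel.dir K).2 ≤ c₁))) → ∀ h ∈ (ι.model V).configs, ∀ h' ∈ (ι.model V).configs, ∀ c ∈ Literature.Probability.Percolation.cornerSet (ι.model V).piece, (ι.model V).IsCut c → (ι.model V).bit h c = (ι.model V).bit h' c :=
  fun ι V hadm hflat hchart h hh h' hh' c hc hcut => forcedBits ι V hadm hflat hchart h hh h' hh' c hc hcut

end Summit.CriticalPhenomena.CardyFormulaZ2.Cruxes.BoundaryDefectGaussianR.RainbowMonomialsInExcursionKernels
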